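import Mathlib.Analysis.SpecialFunctions.Trigonometric.Basic
import Mathlib.Analysis.SpecialFunctions.Trigonometric.Deriv
import Mathlib.Analysis.Calculus.Deriv.MeanValue
import HarnessLib

/-!
# The zonal spectral gap of `S²` (Shvydkoy 2018, proof of Prop. 3.1: `Δf = -(2-α)(1-α) f` has no
# zonal solution for `0 < (2-α)(1-α) < 2`)

R. Shvydkoy, *Homogeneous solutions to the 3D Euler system*, Trans. Amer. Math. Soc. 370 (2018)
2517–2535 = arXiv:1510.03378 [`Shvydkoy2018`], Proposition 3.1 (arXiv p. 8): an irrotational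
homogeneous stationary Euler flow of degree `-α` has normal component `f` solving "the classical
eigenvalue problem for the Laplace-Beltrami operator `Δ f = -(2-α)(1-α) f = -(l+1) l f`", so that
`f` is a spherical harmonic and `α ∈ ℤ ∖ {1}` — in particular there is NO non-trivial solution when
`λ = (2-α)(1-α)` lies strictly between the first two eigenvalues `0` and `2` of `-Δ_{S²}`, i.e. for
`0 < α < 1` (the range used in Prop. 5.1 via Prop. 3.2).

This file proves the axisymmetric (zonal) case of that spectral statement as a fact about one
real function of the polar angle `φ ∈ [0, π]`, with NO spherical harmonics, Legendre functions or
Hodge theory: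

* `Shvydkoy2018.zonal_eigenfunction_eq_zero` — if `f : ℝ → ℝ` is twice differentiable,
  `sin φ · f'' + cos φ · f' = -λ sin φ · f` on `(0, π)` (the zonal Laplace–Beltrami equation
  `f'' + cot φ f' = -λ f`, multiplied by `sin φ`), `f'(0) = f'(π) = 0` (smoothness at the poles) and
  `0 < λ < 2`, then `f ≡ 0` on `[0, π]`.

## Proof (Lichnerowicz's estimate `λ₁(S²) ≥ 2` in one variable, integral-free)

The Bochner identity on `S²` (`Ric = 1`) gives `∫(Δf)² = ∫|∇²f|² + ∫|∇f|² ≥ ½∫(Δf)² + ∫|∇f|²`, whence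
`λ ≥ 2` for a non-zero eigenfunction. For zonal `f` this is the following elementary computation:
the function `Λ(φ) = 2 cos φ · f'(φ)² + 2 sin φ · f'(φ) f(φ)` satisfies, using the equation,
`sin φ · Λ'(φ) = -(λ sin φ · f + 2 cos φ · f')² - λ(2-λ) sin²φ · f² ≤ 0` on `(0,π)`, so `Λ` is
non-increasing on `[0,π]`; but `Λ(0) = 2 f'(0)² = 0 = -2 f'(π)² = Λ(π)`, so `Λ` is constant, `Λ' ≡ 0`,
and `λ(2-λ) sin²φ · f² ≡ 0` forces `f ≡ 0` on `(0,π)`, hence on `[0,π]` by continuity.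

## References

* R. Shvydkoy, Trans. Amer. Math. Soc. 370 (2018) 2517–2535, doi:10.1090/tran/7022 =
  arXiv:1510.03378, Prop. 3.1 and its proof (eq. (19), the eigenvalue problem). [`Shvydkoy2018`]
* A. Lichnerowicz, *Géométrie des groupes de transformations*, Dunod 1958, §III (the estimate
  `λ₁ ≥ n K/(n-1)`), here only as the guiding idea.
-/

noncomputable section

open Set Filter
open scoped Topology

namespace Literature.Analysis.FluidPDE

namespace Shvydkoy2018

/-- A continuous function on `[a, b]` with zero derivative on `(a, b)` is constant there
(mean value theorem, packaged for one-sided use). [folklore] -/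
private theorem eq_of_hasDerivAt_zero_Ioo {g : ℝ → ℝ} {a b : ℝ} (hab : a ≤ b)
    (hcont : ContinuousOn g (Icc a b)) (hderiv : ∀ x ∈ Ioo a b, HasDerivAt g 0 x) :
    ∀ x ∈ Icc a b, g x = g a := by
  have hdiff : DifferentiableOn ℝ g (interior (Icc a b)) := by
    rw [interior_Icc]; exact fun x hx => (hderiv x hx).differentiableAt.differentiableWithinAt
  have hd0 : ∀ x ∈ interior (Icc a b), deriv g x = 0 := by
    rw [interior_Icc]; exact fun x hx => (hderiv x hx).deriv
  have hmono : MonotoneOn g (Icc a b) :=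
    monotoneOn_of_deriv_nonneg (convex_Icc a b) hcont hdiff fun x hx => (hd0 x hx).symm.le
  have hanti : AntitoneOn g (Icc a b) :=
    antitoneOn_of_deriv_nonpos (convex_Icc a b) hcont hdiff fun x hx => (hd0 x hx).le
  intro x hx
  have ha : a ∈ Icc a b := left_mem_Icc.mpr hab
  exact le_antisymm (hanti ha hx hx.1) (hmono ha hx hx.1)

/-- **The zonal spectral gap of `S²`** (the step "`Δf = -(2-α)(1-α) f`, hence `f = Y_l^m` and
`α ∈ ℤ`" of Shvydkoy 2018, Prop. 3.1, for axisymmetric `f` and `0 < λ < 2`): if `f : ℝ → ℝ` is twice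
differentiable with `sin φ · f''(φ) + cos φ · f'(φ) = -λ sin φ · f(φ)` for `φ ∈ (0,π)` (the zonal
Laplace–Beltrami eigenvalue equation `f'' + cot φ · f' = -λ f`), `f'(0) = f'(π) = 0`, and
`0 < λ < 2`, then `f(φ) = 0` for all `φ ∈ [0, π]` — there is no eigenvalue of `-Δ_{S²}` strictly
between `0` and `2` (Lichnerowicz). [cite: Shvydkoy2018, Prop. 3.1] -/
theorem zonal_eigenfunction_eq_zero {f f' f'' : ℝ → ℝ} {lam : ℝ} (h0 : 0 < lam) (h2 : lam < 2)
    (hf : ∀ x, HasDerivAt f (f' x) x) (hf' : ∀ x, HasDerivAt f' (f'' x) x)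
    (hode : ∀ φ ∈ Ioo 0 Real.pi,
      Real.sin φ * f'' φ + Real.cos φ * f' φ = -lam * Real.sin φ * f φ)
    (hp0 : f' 0 = 0) (hpπ : f' Real.pi = 0) : ∀ φ ∈ Icc 0 Real.pi, f φ = 0 := by
  -- the Lichnerowicz function `Λ = 2 cos φ f'² + 2 sin φ f' f` and its derivative
  set Λ : ℝ → ℝ := fun φ => 2 * Real.cos φ * f' φ ^ 2 + 2 * Real.sin φ * f' φ * f φ with hΛ
  set D : ℝ → ℝ := fun φ => 4 * Real.cos φ * f' φ * f'' φ +
    2 * f φ * (Real.cos φ * f' φ + Real.sin φ * f'' φ) with hD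
  have hΛd : ∀ φ, HasDerivAt Λ (D φ) φ := by
    intro φ
    have hc := Real.hasDerivAt_cos φ
    have hs := Real.hasDerivAt_sin φ
    have e1 := (hc.mul ((hf' φ).pow 2)).const_mul 2
    have e2 := ((hs.mul (hf' φ)).mul (hf φ)).const_mul 2
    have e := e1.add e2
    have hfun : Λ = ((fun y => 2 * (Real.cos * f' ^ 2) y) + fun y => 2 * (Real.sin * f' * f) y) := by
      funext x; simp only [hΛ, Pi.add_apply, Pi.mul_apply, Pi.pow_apply]; ring
    rw [hfun]
    refine e.congr_deriv ?_
    simp only [hD, Pi.mul_apply, Pi.pow_apply]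
    norm_num
    ring
  -- `sin φ · Λ' ≤ 0` on `(0, π)`
  have hkey : ∀ φ ∈ Ioo 0 Real.pi, Real.sin φ * D φ =
      -(lam * Real.sin φ * f φ + 2 * Real.cos φ * f' φ) ^ 2
        - lam * (2 - lam) * (Real.sin φ * f φ) ^ 2 := by
    intro φ hφ
    have hX : Real.sin φ * f'' φ = -lam * Real.sin φ * f φ - Real.cos φ * f' φ := by
      linarith [hode φ hφ]
    simp only [hD]
    linear_combination (4 * Real.cos φ * f' φ + 2 * Real.sin φ * f φ) * hX
  have hDle : ∀ φ ∈ Ioo 0 Real.pi, D φ ≤ 0 := by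
    intro φ hφ
    have hs : 0 < Real.sin φ := Real.sin_pos_of_pos_of_lt_pi hφ.1 hφ.2
    have hle : Real.sin φ * D φ ≤ 0 := by
      rw [hkey φ hφ]
      have h2l : 0 ≤ lam * (2 - lam) := by nlinarith
      nlinarith [sq_nonneg (lam * Real.sin φ * f φ + 2 * Real.cos φ * f' φ),
        mul_nonneg h2l (sq_nonneg (Real.sin φ * f φ))]
    by_contra hpos
    exact absurd hle (not_le.mpr (mul_pos hs (not_le.mp hpos)))
  -- `Λ` is non-increasing on `[0, π]` with `Λ(0) = Λ(π) = 0`, hence `Λ ≡ 0`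
  have hΛc : Continuous Λ := continuous_iff_continuousAt.mpr fun x => (hΛd x).continuousAt
  have hanti : AntitoneOn Λ (Icc 0 Real.pi) := by
    refine antitoneOn_of_deriv_nonpos (convex_Icc 0 Real.pi) hΛc.continuousOn ?_ ?_
    · rw [interior_Icc]; exact fun x hx => (hΛd x).differentiableAt.differentiableWithinAt
    · rw [interior_Icc]; intro x hx; rw [(hΛd x).deriv]; exact hDle x hx
  have hΛ0 : Λ 0 = 0 := by simp [hΛ, hp0]
  have hΛπ : Λ Real.pi = 0 := by simp [hΛ, hpπ]
  have hΛzero : ∀ x ∈ Icc 0 Real.pi, Λ x = 0 := by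
    intro x hx
    have h0m : (0 : ℝ) ∈ Icc 0 Real.pi := left_mem_Icc.mpr Real.pi_pos.le
    have hπm : Real.pi ∈ Icc 0 Real.pi := right_mem_Icc.mpr Real.pi_pos.le
    have h1 : Λ x ≤ Λ 0 := hanti h0m hx hx.1
    have h2 : Λ Real.pi ≤ Λ x := hanti hx hπm hx.2
    linarith
  -- so `Λ' = D ≡ 0` on `(0, π)`, and the equation forces `f = 0` there
  have hIoo : ∀ φ ∈ Ioo 0 Real.pi, f φ = 0 := by
    intro φ hφ
    have hev : Λ =ᶠ[𝓝 φ] fun _ => (0 : ℝ) := by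
      filter_upwards [isOpen_Ioo.mem_nhds hφ] with y hy
      exact hΛzero y (Ioo_subset_Icc_self hy)
    have hD0 : D φ = 0 := (hΛd φ).unique ((hasDerivAt_const φ (0 : ℝ)).congr_of_eventuallyEq hev)
    have hs : 0 < Real.sin φ := Real.sin_pos_of_pos_of_lt_pi hφ.1 hφ.2
    have hsum : -(lam * Real.sin φ * f φ + 2 * Real.cos φ * f' φ) ^ 2
        - lam * (2 - lam) * (Real.sin φ * f φ) ^ 2 = 0 := by
      rw [← hkey φ hφ, hD0, mul_zero]
    have h2l : 0 < lam * (2 - lam) := by nlinarith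
    have hsq : (Real.sin φ * f φ) ^ 2 = 0 := by
      nlinarith [sq_nonneg (lam * Real.sin φ * f φ + 2 * Real.cos φ * f' φ),
        sq_nonneg (Real.sin φ * f φ)]
    have hsf : Real.sin φ * f φ = 0 := pow_eq_zero_iff two_ne_zero |>.mp hsq
    exact (mul_eq_zero.mp hsf).resolve_left hs.ne'
  -- and on `[0, π]` by continuity
  have hfc : Continuous f := continuous_iff_continuousAt.mpr fun x => (hf x).continuousAt
  have hclosed : IsClosed {x : ℝ | f x = 0} := isClosed_eq hfc continuous_const
  have hsub : closure (Ioo 0 Real.pi) ⊆ {x : ℝ | f x = 0} :=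
    closure_minimal (fun x hx => hIoo x hx) hclosed
  rw [closure_Ioo Real.pi_pos.ne] at hsub
  exact fun φ hφ => hsub hφ

end Shvydkoy2018

end Literature.Analysis.FluidPDE
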